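import Summits.BirchSwinnertonDyer.Rank1Residual.X11b.BDPRouteSelmerLevelCountExact
import HarnessLib

/-!
# Crux `AnticycControlAdditiveK` (route `SchneiderFreeAdditiveX3`, item stmt-BirchSwinnertonDyer-19295),
# stub `stub_baseCountTors` (P6-add-tors) on regime B2 (`E(K)[p] ≠ 0`) — part 1:
# THE EXACT LEVEL COUNT `#H¹_{𝓛^{(k)}}(K, E[p^k]) = S · p^{e+s} · G` WITHOUT `E(K)[p] = 0`

Seat `bsd-schneider-door-c6`, gen 2 (cell `bsd-schneider-ideate`). Sub-cell multr1-p2's EXACT level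
count `X11b.SelmerLevelCount.natCard_level_eq_of_indices` (JSW17 Prop. 3.2.1 `=` at level `p^k`, four
symbolic local indices at `𝔭`) uses `E(K)[p] = 0` at exactly TWO points: the rank-one identity
`[E(K) : p^k E(K)] = p^k` (hypothesis `hN`), and `KummerDecomp.res_mem_map_of_nsmul_le_range` (the image
of the relaxed group `kummerOutside E (p^k) {𝔭̄}` at the strict place `𝔭` lies in
`κ_𝔭(im E(K) + E(K_𝔭)_tors + p^{k−c}E(K_𝔭))`). Both survive ARBITRARY rational torsion:

* §1 `exists_nsmul_sub_kummerMapTorsion_eq_torsion`, `mem_map_localKummerMap_of_nsmul_eq_torsion`,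
  **`res_mem_map_of_nsmul_le_range_anyTorsion`** — the same local Kummer coordinates with NO
  hypothesis on `E(K)[p]`: if `p^c • X ⊆ κ_N(E(K))`, every `x ∈ X` is `κ_N(P) + f` with
  `p^c f = κ_N(τ)`, `τ ∈ E(K)_tors` (instead of `p^c f = 0`), and a local Kummer class with
  `p^c κ_{N,v}(Q) = κ_{N,v}(τ)` is still the class of a point of `E(K_v)_tors + p^{k−c} E(K_v)`
  (the torsion of `E(K)` maps INTO the torsion of `E(K_v)`, which the condition at `𝔭` reads modulo).
* §2 **`natCard_level_eq_of_indices_anyTorsion`** — multr1-p2's theorem VERBATIM (credit: multr1-p2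
  gen 19) with `hE` deleted and `hN : [E(K) : p^kE(K)] = p^k · G`; conclusion
  `#H¹_{𝓛^{(k)}}(K, E[p^k]) = S · p^{e+s} · G`. For `E(K)` of rank one, `G = #E(K)_tors/p^k = #E(K)[p^∞]`
  at a deep level and `e` drops by `ord_p #E(K)[p^∞]`: the level count is the SAME number as at `g = 0`.

CONDITIONAL on the cited `poitouTate_selmerStructure_duality K` and `localEulerPoincareCharacteristic (K_v)`
(hypotheses, as in multr1-p2); no `Prop` fact minted; closes nothing by itself; BSD is not proved by this.
References: [JetchevSkinnerWan2017] Prop. 3.2.1 (arXiv:1512.06894 pp. 10–11); [Castella2018] Thm. 2.3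
(arXiv:1704.06608 pp. 5–6); [MilneADT2006] I 4.10, 2.8, §6; [GreenbergLNM1716] §5 proof of Prop. 5.8.
-/

noncomputable section

open scoped Classical

universe u

set_option linter.dupNamespace false

namespace Summit.BirchSwinnertonDyer.BirchSwinnertonDyer.Theorems.SchneiderFreeAdditiveX3

open CategoryTheory WeierstrassCurve NumberField IsDedekindDomain Field Function
open Literature.NumberTheory.EllipticCurves Literature.NumberTheory.EllipticCurves.GreenbergSelmer
open Literature.NumberTheory.GaloisRepresentations Literature.NumberTheory.GaloisCohomology
open Summit.BirchSwinnertonDyer.Rank1Residual.X11b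
open Summit.BirchSwinnertonDyer.Rank1Residual.X11b.AcSelmer
open Summit.BirchSwinnertonDyer.Rank1Residual.X11b.LocBridge
open scoped ContRepresentation

/-! ## §1. Local Kummer coordinates modulo torsion, WITHOUT `E(K)[p] = 0` -/

section KummerDecompAnyTorsion

variable {K : Type u} [Field K] [NumberField K] (W : WeierstrassCurve K) [W.IsElliptic]
  {N : ℤ} (hN : N ≠ 0) (p k : ℕ) [Fact p.Prime]

/-- **Classes congruent to Kummer classes modulo `p^c`, ANY torsion.** At level `N = p^k`: if
`p^c • X ⊆ κ_N(E(K))` for a subgroup `X ≤ H¹(K, E[p^k])` (`c ≤ k`), then every `x ∈ X` is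
`κ_N(P) + f` with `p^c • f = κ_N(τ)` for a TORSION point `τ ∈ E(K)` (with `E(K)[p] = 0` one gets
`p^c f = 0`, `KummerDecomp.exists_nsmul_sub_kummerMapTorsion_eq_zero`). Proof: `p^c x = κ_N(P₁)`,
`p^k x = 0` forces `p^{k−c} P₁ = p^k P'`, so `τ := P₁ − p^c P'` is killed by `p^{k−c}`.
[cite: GreenbergLNM1716, §5 proof of Prop. 5.8] [cite: SilvermanAEC2009, §VIII.2 (exactness at E(K)/mE(K))] -/
theorem exists_nsmul_sub_kummerMapTorsion_eq_torsion (hNk : N = ((p ^ k : ℕ) : ℤ))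
    (X : AddSubgroup (galH1Torsion W N)) {c : ℕ} (hc : c ≤ k)
    (hX : ∀ x ∈ X, p ^ c • x ∈ (kummerMapTorsion W N (W.zsmul_geomPoints_surjective_holds hN)).range)
    {x : galH1Torsion W N} (hx : x ∈ X) :
    ∃ P τ : W.toAffine.Point, IsOfFinAddOrder τ ∧
      p ^ c • (x - kummerMapTorsion W N (W.zsmul_geomPoints_surjective_holds hN) P) =
        kummerMapTorsion W N (W.zsmul_geomPoints_surjective_holds hN) τ := by
  haveI : PerfectField K := PerfectField.ofCharZero
  have hp : p.Prime := Fact.out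
  obtain ⟨P₁, hP₁⟩ := hX x hx
  have hz : p ^ (k - c) • (p ^ c • x) = 0 := by
    rw [smul_smul, ← pow_add, Nat.sub_add_cancel hc]
    exact KummerDecomp.pow_nsmul_galH1Torsion_eq_zero W p k hNk x
  have hker : p ^ (k - c) • P₁ ∈
      (kummerMapTorsion W N (W.zsmul_geomPoints_surjective_holds hN)).ker := by
    rw [AddMonoidHom.mem_ker, map_nsmul, hP₁, hz]
  rw [kummerMapTorsion_ker] at hker
  obtain ⟨P', hP'⟩ := hker
  rw [zsmulAddGroupHom_apply, hNk, natCast_zsmul] at hP'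
  refine ⟨P', P₁ - p ^ c • P', ?_, ?_⟩
  · refine isOfFinAddOrder_iff_nsmul_eq_zero.mpr ⟨p ^ (k - c), pow_pos hp.pos _, ?_⟩
    rw [smul_sub, smul_smul, ← pow_add, Nat.sub_add_cancel hc, hP', sub_self]
  · rw [smul_sub, map_sub, map_nsmul, hP₁]

/-- **A local Kummer class congruent to the class of a torsion point modulo `p^c` is the class of a
point of `E(K_v)_tors + p^{k−c} E(K_v)`** (level `N = p^k`, any `K`-field of characteristic `0`): if
`p^c κ_N(Q) = κ_N(τ)` with `τ` torsion then `p^c Q − τ = p^k R`, so `p^c (Q − p^{k−c} R) = τ` and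
`Q − p^{k−c} R` is torsion. [cite: SilvermanAEC2009, §VIII.2 (exactness at E(K)/mE(K))] -/
theorem mem_map_localKummerMap_of_nsmul_eq_torsion (hNk : N = ((p ^ k : ℕ) : ℤ))
    (E : Type u) [Field E] [Algebra K E] [CharZero E]
    {f : galoisCohomology (GaloisRep.restrictField E (W.torsionGaloisModule N)) 1}
    (hf : f ∈ W.kummerLocalConditionAt N E) {c : ℕ} (hc : c ≤ k)
    {τ : (W.baseChange E).toAffine.Point} (hτ : IsOfFinAddOrder τ)
    (hcf : p ^ c • f = W.localKummerMap E hN τ) :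
    f ∈ (AddCommGroup.torsion (W.baseChange E).toAffine.Point ⊔
        (zsmulAddGroupHom ((p ^ (k - c) : ℕ) : ℤ) : (W.baseChange E).toAffine.Point →+ _).range).map
      (W.localKummerMap E hN) := by
  have hp : p.Prime := Fact.out
  rw [← W.range_localKummerMap E hN] at hf
  obtain ⟨Q, rfl⟩ := hf
  have hker : p ^ c • Q - τ ∈ (W.localKummerMap E hN).ker := by
    rw [AddMonoidHom.mem_ker, map_sub, map_nsmul, hcf, sub_self]
  rw [W.ker_localKummerMap E hN] at hker
  obtain ⟨R, hR⟩ := hker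
  rw [zsmulAddGroupHom_apply, hNk, natCast_zsmul] at hR
  have h0 : p ^ c • (Q - p ^ (k - c) • R) = τ := by
    rw [smul_sub, smul_smul, pow_mul_pow_sub p hc, hR, sub_sub_cancel]
  have htors : Q - p ^ (k - c) • R ∈ AddCommGroup.torsion (W.baseChange E).toAffine.Point := by
    obtain ⟨n, hn, hnτ⟩ := hτ.exists_nsmul_eq_zero
    exact (AddCommGroup.mem_torsion _).mpr (isOfFinAddOrder_iff_nsmul_eq_zero.mpr
      ⟨n * p ^ c, Nat.mul_pos hn (pow_pos hp.pos c), by rw [mul_smul, h0, hnτ]⟩)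
  refine ⟨Q, ?_, rfl⟩
  have hQ : Q = (Q - p ^ (k - c) • R) + p ^ (k - c) • R := (sub_add_cancel Q _).symm
  rw [hQ]
  exact AddSubgroup.add_mem_sup htors ⟨R, by rw [zsmulAddGroupHom_apply, natCast_zsmul]⟩

/-- **The local Kummer coordinates of a subgroup `X ≤ H¹(K, E[p^k])` with `p^c • X ⊆ κ_N(E(K))`, at a
`K`-field `E` (a completion) where its classes are Kummer, ANY rational torsion**:
`res_E(X) ⊆ κ_{N,E}(im E(K) + (W⁄E)(E)_tors + p^{k−c} (W⁄E)(E))` — the statement of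
`KummerDecomp.res_mem_map_of_nsmul_le_range` with its hypothesis `E(K)[p] = 0` REMOVED (the torsion of
`E(K)` maps into the torsion of `(W⁄E)(E)`). Used for `X = kummerOutside W (p^k) {𝔭̄}` at the strict
place `v = 𝔭` of Castella's Selmer group, where the condition is read modulo torsion.
[cite: JetchevSkinnerWan2017, Prop. 3.2.1 and §3.3.1 (arXiv:1512.06894 pp. 10–11)]
[cite: GreenbergLNM1716, §5 proof of Prop. 5.8] -/
theorem res_mem_map_of_nsmul_le_range_anyTorsion (hNk : N = ((p ^ k : ℕ) : ℤ))
    (X : AddSubgroup (galH1Torsion W N)) {c : ℕ} (hc : c ≤ k)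
    (hX : ∀ x ∈ X, p ^ c • x ∈ (kummerMapTorsion W N (W.zsmul_geomPoints_surjective_holds hN)).range)
    (E : Type u) [Field E] [Algebra K E] [CharZero E]
    (hXE : ∀ x ∈ X, galoisCohomology.res (W.torsionGaloisModule N) E 1 x ∈ W.kummerLocalConditionAt N E)
    {x : galH1Torsion W N} (hx : x ∈ X) :
    galoisCohomology.res (W.torsionGaloisModule N) E 1 x ∈
      ((Affine.Point.baseChange (W' := W) K E).range ⊔
        (AddCommGroup.torsion (W.baseChange E).toAffine.Point ⊔
          (zsmulAddGroupHom ((p ^ (k - c) : ℕ) : ℤ) : (W.baseChange E).toAffine.Point →+ _).range)).map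
        (W.localKummerMap E hN) := by
  obtain ⟨P, τ, hτ, hP⟩ :=
    exists_nsmul_sub_kummerMapTorsion_eq_torsion W hN p k hNk X hc hX hx
  set f : galH1Torsion W N :=
    x - kummerMapTorsion W N (W.zsmul_geomPoints_surjective_holds hN) P with hfdef
  have hκP : galoisCohomology.res (W.torsionGaloisModule N) E 1
      (kummerMapTorsion W N (W.zsmul_geomPoints_surjective_holds hN) P) =
      W.localKummerMap E hN (Affine.Point.baseChange (W' := W) K E P) :=
    KummerIndex.res_kummerMapTorsion_eq_localKummerMap W E hN _ P
  have hκτ : galoisCohomology.res (W.torsionGaloisModule N) E 1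
      (kummerMapTorsion W N (W.zsmul_geomPoints_surjective_holds hN) τ) =
      W.localKummerMap E hN (Affine.Point.baseChange (W' := W) K E τ) :=
    KummerIndex.res_kummerMapTorsion_eq_localKummerMap W E hN _ τ
  -- `res_E f` is Kummer and `p^c • res_E f = κ_{N,E}(τ_E)`
  have hfE : galoisCohomology.res (W.torsionGaloisModule N) E 1 f ∈ W.kummerLocalConditionAt N E := by
    rw [hfdef, KummerDecomp.res_sub, hκP]
    exact AddSubgroup.sub_mem _ (hXE x hx) (W.localKummerMap_mem E hN _)
  have hcf : p ^ c • galoisCohomology.res (W.torsionGaloisModule N) E 1 f =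
      W.localKummerMap E hN (Affine.Point.baseChange (W' := W) K E τ) := by
    rw [← KummerDecomp.res_nsmul, hP, hκτ]
  have hτE : IsOfFinAddOrder (Affine.Point.baseChange (W' := W) K E τ) :=
    (Affine.Point.baseChange (W' := W) K E).isOfFinAddOrder hτ
  obtain ⟨Q, hQ, hQf⟩ := mem_map_localKummerMap_of_nsmul_eq_torsion W hN p k hNk E hfE hc hτE hcf
  -- `res_E x = κ_{N,E}(P_E) + res_E f`
  have hx' : x = kummerMapTorsion W N (W.zsmul_geomPoints_surjective_holds hN) P + f := by
    rw [hfdef, add_sub_cancel]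
  rw [hx', KummerDecomp.res_add, hκP, ← hQf, ← map_add]
  exact ⟨_, AddSubgroup.add_mem_sup ⟨P, rfl⟩ hQ, rfl⟩

end KummerDecompAnyTorsion

/-! ## §2. The exact level count with a torsion factor `G` -/

section Level

variable (W : WeierstrassCurve ℚ) [W.IsElliptic] (K : Type) [Field K] [NumberField K]
  (p k : ℕ) [Fact p.Prime] (𝔭 𝔮 : HeightOneSpectrum (𝓞 K))

/-- **THE EXACT LEVEL COUNT WITHOUT (iv) AND WITHOUT `E(K)[p] = 0` (JSW17 Prop. 3.2.1 `=` at level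
`p^k`, indices symbolic).** For `K` with all infinite places complex, `p = 𝔭𝔮` (`𝔮 = σ𝔭 ≠ 𝔭`),
`n = p^k`: if `[E(K) : nE(K)] = n · G`, `[E(K_𝔭) : T + nE(K_𝔭)] = n`,
`[E(K_𝔭) : im E(K) + p^{k'}E(K_𝔭)] = p^e` for `k' ∈ {k, k-j}`,
`[E(K_𝔭) : im E(K) + T + p^{k'}E(K_𝔭)] = p^s` for `k' ∈ {k, k-e-j}`, `#(Ш ∩ H¹[n]) = S` and
`p^j (Ш ∩ H¹[n]) = 0` (`s + e + j ≤ k`), then `#H¹_{𝓛^{(k)}}(K, E[p^k]) = S · p^{e+s} · G` EXACTLY —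
multr1-p2's `SelmerLevelCount.natCard_level_eq_of_indices` VERBATIM (credit: sub-cell multr1-p2, gen 19)
with the global index identity carrying the torsion factor `G` (`#Sel⁽ⁿ⁾ = n·G·S`) and §1's
`res_mem_map_of_nsmul_le_range_anyTorsion` in place of the `E(K)[p] = 0` version. CONDITIONAL on
`poitouTate_selmerStructure_duality K` and `localEulerPoincareCharacteristic (K_v)` (all finite `v`),
hypotheses. [cite: JetchevSkinnerWan2017, Prop. 3.2.1 (proof, arXiv:1512.06894 pp. 10–11)]
[cite: Castella2018, proof of Thm. 2.3, (3.2.1) and (calcul) (arXiv:1704.06608 pp. 5–6)]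
[cite: MilneADT2006, Ch. I, Thm. 4.10 and Thm. 2.8] -/
theorem natCard_level_eq_of_indices_anyTorsion (hK : ∀ w : InfinitePlace K, w.IsComplex) (hk : 0 < k)
    (σ : K ≃ₐ[ℚ] K) (hσ : σ • 𝔭 = 𝔮) (h𝔮p : ((p : ℕ) : 𝓞 K) ∈ 𝔮.asIdeal) (hne : 𝔮 ≠ 𝔭)
    (hall : ∀ v : HeightOneSpectrum (𝓞 K), ((p : ℕ) : 𝓞 K) ∈ v.asIdeal → v = 𝔭 ∨ v = 𝔮)
    (hPT : poitouTate_selmerStructure_duality K)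
    (hEP : ∀ v : HeightOneSpectrum (𝓞 K), localEulerPoincareCharacteristic (v.adicCompletion K))
    (T : Finset (Place K)) (hinf : ∀ w : InfinitePlace K, (Sum.inl w : Place K) ∈ T)
    (hpT : ∀ v : HeightOneSpectrum (𝓞 K), ((p : ℕ) : 𝓞 K) ∈ v.asIdeal → (Sum.inr v : Place K) ∈ T)
    (hbad : ∀ v : HeightOneSpectrum (𝓞 K), ¬ (W.baseChange K).HasGoodReductionAt v →
      (Sum.inr v : Place K) ∈ T)
    (h𝔮T : (Sum.inr 𝔮 : Place K) ∈ T)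
    {e s j S G : ℕ} (hjk : e + j ≤ k) (hsk : s + (e + j) ≤ k)
    (hN : ((zsmulAddGroupHom ((p ^ k : ℕ) : ℤ) : (W.baseChange K).toAffine.Point →+ _).range).index =
      p ^ k * G)
    (hM : (AddCommGroup.torsion ((W.baseChange K).baseChange (𝔭.adicCompletion K)).toAffine.Point ⊔
        (zsmulAddGroupHom ((p ^ k : ℕ) : ℤ) :
          ((W.baseChange K).baseChange (𝔭.adicCompletion K)).toAffine.Point →+ _).range).index = p ^ k)
    (hL₁ : ((Affine.Point.baseChange (W' := W.baseChange K) K (𝔭.adicCompletion K)).range ⊔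
        (zsmulAddGroupHom ((p ^ k : ℕ) : ℤ) :
          ((W.baseChange K).baseChange (𝔭.adicCompletion K)).toAffine.Point →+ _).range).index = p ^ e)
    (hL₁' : ((Affine.Point.baseChange (W' := W.baseChange K) K (𝔭.adicCompletion K)).range ⊔
        (zsmulAddGroupHom ((p ^ (k - j) : ℕ) : ℤ) :
          ((W.baseChange K).baseChange (𝔭.adicCompletion K)).toAffine.Point →+ _).range).index = p ^ e)
    (hL₂ : ((Affine.Point.baseChange (W' := W.baseChange K) K (𝔭.adicCompletion K)).range ⊔
        (AddCommGroup.torsion ((W.baseChange K).baseChange (𝔭.adicCompletion K)).toAffine.Point ⊔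
          (zsmulAddGroupHom ((p ^ k : ℕ) : ℤ) :
            ((W.baseChange K).baseChange (𝔭.adicCompletion K)).toAffine.Point →+ _).range)).index =
      p ^ s)
    (hL₂' : ((Affine.Point.baseChange (W' := W.baseChange K) K (𝔭.adicCompletion K)).range ⊔
        (AddCommGroup.torsion ((W.baseChange K).baseChange (𝔭.adicCompletion K)).toAffine.Point ⊔
          (zsmulAddGroupHom ((p ^ (k - (e + j)) : ℕ) : ℤ) :
            ((W.baseChange K).baseChange (𝔭.adicCompletion K)).toAffine.Point →+ _).range)).index =
      p ^ s)
    (hS : Nat.card ↥((W.baseChange K).sha ⊓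
        AddSubgroup.torsionBy (W.baseChange K).galH1 ((p ^ k : ℕ) : ℤ)) = S)
    (hShaj : ∀ z ∈ (W.baseChange K).sha ⊓
        AddSubgroup.torsionBy (W.baseChange K).galH1 ((p ^ k : ℕ) : ℤ), p ^ j • z = 0) :
    Finite (acLevelStructure (W.baseChange K) p k 𝔭 ∅).selmerGroup ∧
      Nat.card (acLevelStructure (W.baseChange K) p k 𝔭 ∅).selmerGroup = S * p ^ (e + s) * G := by
  haveI hEK : (W.baseChange K).IsElliptic := by rw [baseChange]; infer_instance
  have hp : p.Prime := Fact.out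
  haveI : NeZero (p ^ k) := ⟨pow_ne_zero _ hp.ne_zero⟩
  haveI : CharZero (𝔭.adicCompletion K) := charZero_adicCompletion 𝔭
  haveI : CharZero (𝔮.adicCompletion K) := charZero_adicCompletion 𝔮
  have hnZ : ((p ^ k : ℕ) : ℤ) ≠ 0 := Int.natCast_ne_zero.mpr (NeZero.ne _)
  set E := W.baseChange K with hE_def
  have hdiv := E.zsmul_geomPoints_surjective_holds hnZ
  set Sel := selmerGroup E ((p ^ k : ℕ) : ℤ) with hSel
  set KO := kummerOutside E (p ^ k) {Sum.inr 𝔮} with hKO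
  have hSelKO : Sel ≤ KO := selmerGroup_le_kummerOutside E (p ^ k) _
  haveI hKOfin : Finite KO := SelmerLevelBound.finite_kummerOutside E (p ^ k) {Sum.inr 𝔮}
  have hppos : ∀ t : ℕ, 0 < p ^ t := fun t => pow_pos hp.pos t
  -- the glue with Castella's level group (multr1-p2 gen 19, file A)
  have hglue := LevelKummer.selmerGroup_acLevelStructure_eq_inf_torsion E p k 𝔭 𝔮 hK h𝔮p hne hall hnZ
  -- §A. AT `𝔮`: `[KO : Sel] = [𝓛_𝔮 : loc_𝔮 Sel] = p^e`
  set res𝔮 := galoisCohomology.res (E.torsionGaloisModule ((p ^ k : ℕ) : ℤ)) (𝔮.adicCompletion K) 1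
    with hres𝔮
  set κ𝔮 := E.localKummerMap (𝔮.adicCompletion K) hnZ with hκ𝔮
  set ι𝔮 := Affine.Point.baseChange (W' := E) K (𝔮.adicCompletion K) with hι𝔮
  set L𝔮 := E.kummerLocalConditionAt ((p ^ k : ℕ) : ℤ) (𝔮.adicCompletion K) with hL𝔮
  set HS := Sel.map res𝔮 with hHS
  set A₁ := ((kummerMapTorsion E ((p ^ k : ℕ) : ℤ) hdiv).range).map res𝔮 with hA₁
  set A₂ := (ι𝔮.range ⊔ (zsmulAddGroupHom ((p ^ (k - j) : ℕ) : ℤ) :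
      (E.baseChange (𝔮.adicCompletion K)).toAffine.Point →+ _).range).map κ𝔮 with hA₂
  have hκSel : (kummerMapTorsion E ((p ^ k : ℕ) : ℤ) hdiv).range ≤ Sel := by
    rintro _ ⟨P, rfl⟩
    exact StrictAtPlace.kummerMapTorsion_mem_selmerGroup E hdiv P
  have hA₁_le : A₁ ≤ HS := AddSubgroup.map_mono hκSel
  have hL𝔮range : κ𝔮.range = L𝔮 := E.range_localKummerMap _ hnZ
  -- `loc_𝔮 Sel ⊆ κ_𝔮(im E(K) + p^{k-j} E(K_𝔮))` (multr1-p2 gen 19, file B)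
  have hdvd : ((p ^ j : ℕ) : ℤ) ∣ ((p ^ k : ℕ) : ℤ) :=
    Int.natCast_dvd_natCast.mpr (pow_dvd_pow p (by omega))
  have hjZ : ((p ^ j : ℕ) : ℤ) ≠ 0 := Int.natCast_ne_zero.mpr (pow_ne_zero _ hp.ne_zero)
  have hmul : ((p ^ k : ℕ) : ℤ) = ((p ^ (k - j) : ℕ) : ℤ) * ((p ^ j : ℕ) : ℤ) := by
    rw [← Nat.cast_mul, ← pow_add, Nat.sub_add_cancel (by omega)]
  have hShale : E.sha ⊓ AddSubgroup.torsionBy E.galH1 ((p ^ k : ℕ) : ℤ) ≤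
      AddSubgroup.torsionBy E.galH1 ((p ^ j : ℕ) : ℤ) :=
    fun z hz => AddSubgroup.torsionBy.nsmul_iff.mpr (hShaj z hz)
  have hHS_le : HS ≤ A₂ := by
    rintro _ ⟨s', hs', rfl⟩
    exact KummerDecomp.res_mem_map_localKummerMap_of_mem_selmerGroup E hdvd hjZ hnZ hmul hShale
      (Sum.inr 𝔮) hs'
  have hA₂_le : A₂ ≤ L𝔮 := by
    rw [← hL𝔮range]
    exact AddSubgroup.map_le_range _ _
  -- `[𝓛_𝔮 : κ_𝔮(im E(K))] = [E(K_𝔮) : im E(K) + nE(K_𝔮)] = (symmetry) p^e`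
  have hA₁L : A₁.relIndex L𝔮 = p ^ e := by
    rw [hA₁, hL𝔮, KummerIndex.relIndex_map_res_range_kummerMapTorsion E (𝔮.adicCompletion K) hnZ hdiv,
      ← LocalIndexSymmetry.index_range_baseChange_sup_eq_of_algEquiv_smul W σ hσ ((p ^ k : ℕ) : ℤ),
      hL₁]
  -- `[𝓛_𝔮 : κ_𝔮(im E(K) + p^{k-j}E)] = [E(K_𝔮) : im E(K) + p^{k-j}E(K_𝔮)] = p^e`
  have hA₂L : A₂.relIndex L𝔮 = p ^ e := by
    rw [hA₂, ← hL𝔮range, KummerIndex.relIndex_map_range_eq_index_sup_ker, hκ𝔮,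
      E.ker_localKummerMap _ hnZ,
      sup_eq_left.mpr (le_sup_of_le_right
        (SelmerLevelCount.range_zsmul_pow_le_of_le p (Nat.sub_le k j))),
      ← LocalIndexSymmetry.index_range_baseChange_sup_eq_of_algEquiv_smul W σ hσ
        ((p ^ (k - j) : ℕ) : ℤ), hL₁']
  have hHSL : HS.relIndex L𝔮 = p ^ e :=
    SelmerCount.relIndex_eq_of_squeeze_above hA₁_le hHS_le hA₂_le (pow_ne_zero _ hp.ne_zero)
      hA₁L hA₂L
  -- Poitou–Tate, both halves (multr1-p2 gen 19, file D)
  have hD := Relaxation.relIndex_selmerGroup_kummerOutside_eq E p k 𝔮 hK hPT hEP hk.ne' T hinf hpT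
    hbad h𝔮T
  have hB : Sel.relIndex KO = p ^ e := by
    rw [hSel, hKO, hD]
    exact hHSL
  -- `p^e` kills `𝓛_𝔮 / loc_𝔮 Sel`, hence `p^e KO ⊆ Sel` and `p^{e+j} KO ⊆ κ_n(E(K))`
  have hc : ∀ y ∈ E.kummerSelmerStructure ((p ^ k : ℕ) : ℤ) (Sum.inr 𝔮),
      p ^ e • y ∈ (selmerGroup E ((p ^ k : ℕ) : ℤ)).map
        (galoisCohomology.localization (E.torsionGaloisModule ((p ^ k : ℕ) : ℤ)) (Sum.inr 𝔮) 1) :=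
    fun y hy => SelmerCount.nsmul_mem_of_relIndex_eq hA₁_le hA₁L hy
  have hSelc : ∀ x ∈ KO, p ^ e • x ∈ Sel := fun x hx =>
    Relaxation.nsmul_mem_selmerGroup_of_mem_kummerOutside E p k 𝔮 hPT hEP hk.ne' (p ^ e) hc hx
  have hX : ∀ x ∈ KO, p ^ (e + j) • x ∈
      (kummerMapTorsion E ((p ^ k : ℕ) : ℤ) (E.zsmul_geomPoints_surjective_holds hnZ)).range := by
    intro x hx
    rw [pow_add, mul_nsmul]
    exact KummerDecomp.nsmul_mem_range_kummerMapTorsion_of_mem_selmerGroup E hnZ (p ^ j) hShaj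
      (hSelc x hx)
  -- §B. AT `𝔭`: `[KO : C'] = [κ_𝔭(T) + loc_𝔭 KO : κ_𝔭(T)] = p^{k-s}`
  set res𝔭 := galoisCohomology.res (E.torsionGaloisModule ((p ^ k : ℕ) : ℤ)) (𝔭.adicCompletion K) 1
    with hres𝔭
  set κ𝔭 := E.localKummerMap (𝔭.adicCompletion K) hnZ with hκ𝔭
  set ι𝔭 := Affine.Point.baseChange (W' := E) K (𝔭.adicCompletion K) with hι𝔭
  set T𝔭 := AddCommGroup.torsion (E.baseChange (𝔭.adicCompletion K)).toAffine.Point with hT𝔭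
  set Rk := (zsmulAddGroupHom ((p ^ k : ℕ) : ℤ) :
      (E.baseChange (𝔭.adicCompletion K)).toAffine.Point →+ _).range with hRk
  set Rc := (zsmulAddGroupHom ((p ^ (k - (e + j)) : ℕ) : ℤ) :
      (E.baseChange (𝔭.adicCompletion K)).toAffine.Point →+ _).range with hRc
  set Tκ := T𝔭.map κ𝔭 with hTκ
  set X := Tκ ⊔ KO.map res𝔭 with hX_def
  set M₁ := (ι𝔭.range ⊔ (T𝔭 ⊔ Rk)).map κ𝔭 with hM₁
  set M₂ := (ι𝔭.range ⊔ (T𝔭 ⊔ Rc)).map κ𝔭 with hM₂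
  have hkerκ : κ𝔭.ker = Rk := E.ker_localKummerMap _ hnZ
  have hRle : Rk ≤ Rc := SelmerLevelCount.range_zsmul_pow_le_of_le p (Nat.sub_le k (e + j))
  -- `KO` is Kummer at `𝔭`
  have hXE : ∀ x ∈ KO, res𝔭 x ∈ E.kummerLocalConditionAt ((p ^ k : ℕ) : ℤ) (𝔭.adicCompletion K) := by
    intro x hx
    have h𝔭𝔮 : (Sum.inr 𝔭 : Place K) ∉ ({Sum.inr 𝔮} : Finset (Place K)) := fun h =>
      hne.symm (Sum.inr_injective (Finset.mem_singleton.mp h))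
    exact (mem_kummerOutside_iff E (p ^ k) {Sum.inr 𝔮} x).mp hx (Sum.inr 𝔭) h𝔭𝔮
  -- `loc_𝔭 KO ⊆ κ_𝔭(im E(K) + T + p^{k-e-j}E(K_𝔭))` (§1, ANY torsion)
  have hup : KO.map res𝔭 ≤ M₂ := by
    rintro _ ⟨x, hx, rfl⟩
    exact res_mem_map_of_nsmul_le_range_anyTorsion E hnZ p k rfl KO hjk hX
      (𝔭.adicCompletion K) hXE hx
  have h0 : Tκ ≤ M₁ := AddSubgroup.map_mono (le_sup_of_le_right le_sup_left)
  have h1 : M₁ ≤ X := by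
    rintro _ ⟨P, hP, rfl⟩
    obtain ⟨a, ha, b, hb, rfl⟩ := AddSubgroup.mem_sup.mp hP
    obtain ⟨t, ht, r, hr, rfl⟩ := AddSubgroup.mem_sup.mp hb
    obtain ⟨Q, rfl⟩ := ha
    have hr0 : κ𝔭 r = 0 := by rw [← AddMonoidHom.mem_ker, hkerκ]; exact hr
    rw [map_add, map_add, hr0, add_zero, add_comm]
    refine AddSubgroup.add_mem _ (AddSubgroup.mem_sup_left ⟨t, ht, rfl⟩)
      (AddSubgroup.mem_sup_right ⟨kummerMapTorsion E _ hdiv Q, hSelKO (hκSel ⟨Q, rfl⟩), ?_⟩)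
    exact KummerIndex.res_kummerMapTorsion_eq_localKummerMap E (𝔭.adicCompletion K) hnZ hdiv Q
  have h2 : X ≤ M₂ :=
    sup_le (AddSubgroup.map_mono (le_sup_of_le_right le_sup_left)) hup
  -- `[κ_𝔭(im E(K) + T + nE) : κ_𝔭(T)] = [E : T + nE] / [E : im E(K) + T + nE] = p^k / p^s`
  have hM₁T : Tκ.relIndex M₁ = p ^ (k - s) := by
    have hle : T𝔭 ⊔ Rk ≤ ι𝔭.range ⊔ (T𝔭 ⊔ Rk) := le_sup_right
    have hmul := AddSubgroup.relIndex_mul_index hle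
    rw [hL₂, hM] at hmul
    rw [hTκ, hM₁, AddSubgroup.relIndex_map_map, hkerκ,
      sup_eq_left.mpr (le_sup_of_le_right le_sup_right)]
    refine Nat.eq_of_mul_eq_mul_right (hppos s) ?_
    rw [hmul, ← pow_add, Nat.sub_add_cancel (by omega)]
  have hM₂T : Tκ.relIndex M₂ = p ^ (k - s) := by
    have hle : T𝔭 ⊔ Rk ≤ ι𝔭.range ⊔ (T𝔭 ⊔ Rc) :=
      le_sup_of_le_right (sup_le le_sup_left (le_sup_of_le_right hRle))
    have hmul := AddSubgroup.relIndex_mul_index hle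
    rw [hL₂', hM] at hmul
    rw [hTκ, hM₂, AddSubgroup.relIndex_map_map, hkerκ,
      sup_eq_left.mpr (le_sup_of_le_right (le_sup_of_le_right hRle))]
    refine Nat.eq_of_mul_eq_mul_right (hppos s) ?_
    rw [hmul, ← pow_add, Nat.sub_add_cancel (by omega)]
  have hTX : Tκ.relIndex X = p ^ (k - s) :=
    SelmerCount.relIndex_eq_of_squeeze_below h0 h1 h2 (pow_ne_zero _ hp.ne_zero) hM₁T hM₂T
  have hC : (KO ⊓ Tκ.comap res𝔭).relIndex KO = p ^ (k - s) := by
    rw [AddSubgroup.inf_relIndex_left, AddSubgroup.relIndex_comap]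
    have h := hTX
    rwa [hX_def, AddSubgroup.relIndex_sup_left] at h
  -- §C. COUNT: `#C'·[KO : C'] = #KO = #Sel·[KO : Sel]`, `#Sel = n·G·S`
  have hSelcard : Nat.card Sel = p ^ k * G * S := by
    rw [hSel, SelmerCount.natCard_selmerGroup_eq_index_mul E hnZ, hN, hS]
  have h₁ := SelmerCount.card_mul_relIndex_of_le hSelKO
  have h₂ := SelmerCount.card_mul_relIndex_of_le (inf_le_left : KO ⊓ Tκ.comap res𝔭 ≤ KO)
  rw [hB, hSelcard] at h₁
  rw [hC] at h₂
  have h₃ : Nat.card ↥(KO ⊓ Tκ.comap res𝔭) * p ^ (k - s) = p ^ k * G * S * p ^ e :=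
    h₂.trans h₁.symm
  have hcard : Nat.card ↥(KO ⊓ Tκ.comap res𝔭) = S * p ^ (e + s) * G := by
    refine Nat.eq_of_mul_eq_mul_right (hppos (k - s)) ?_
    rw [h₃]
    have hks : k = (k - s) + s := (Nat.sub_add_cancel (by omega)).symm
    conv_lhs => rw [hks]
    ring
  refine ⟨?_, ?_⟩
  · rw [hglue]
    change Finite ↥(KO ⊓ Tκ.comap res𝔭)
    exact Finite.of_injective _ (AddSubgroup.inclusion_injective inf_le_left)
  · rw [hglue]
    change Nat.card ↥(KO ⊓ Tκ.comap res𝔭) = _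
    exact hcard

end Level

end Summit.BirchSwinnertonDyer.BirchSwinnertonDyer.Theorems.SchneiderFreeAdditiveX3

end
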